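import Summits.NavierStokesRegularity.OSWSelfSimilar.SheetREvenEnergySpaceOf
import Summits.NavierStokesRegularity.OSWSelfSimilar.SheetRLiftOfRecord
import Summits.NavierStokesRegularity.OSWSelfSimilar.CertificateViscousSheetRSpectrumEven
import Mathlib.Analysis.Real.Pi.Bounds
import HarnessLib

/-!
# SHEET-ℝ frame, EVEN half: THE EVEN GAUGE LIFT OF RECORD `h⁺ = Σ_{n≤12} h_n e_n⁺` as a kernel object — `h⁺ ∈ WevenZ 8` and `‖h⁺ + 0i‖² ≤ hw2E`
# (hypothesis-ledger rows 14⁺ and 13⁺ of the Z3-SR-SPEC even chain)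

HONEST FRAMING (cell ns-blowup GROUP B / zone Z3, case Z3-SR-SPEC EVEN half; 1-D MODEL certificate frame (viscous gCLM/OSW sheet on the line, frame
`L = 8`); not Euler/NS; «violates: none — MODEL»).  In the even word for the sheet `SheetRSpectrumEvenEndToEnd.eigen_set_eq_singleton_of_record` the
rank-one gauge feedback `4⟪h⁺, ·⟫h⁺` is carried by `{hE : W 8} (hhE : hE ∈ WevenZ h8)` and `hhw : ‖realE h8 hE hhE‖² ≤ hw2E`
(`hw2E = 251895283/250000000`, `CertificateViscousSheetRSpectrumEven.hw2E`; HYPOTHESIS-LEDGER v2.3 rows 14⁺ «`h⁺ ∈ E⁺₀` (even, zero mass)» and 13⁺).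
The even lift of record is candidate A of PREREG-Z3-SR-SPEC-EVEN's P1 lift rule: the 12-mode combination `Σ_{n=1}^{12} h_n·e_n⁺` of the EVEN frame
`e_n⁺(ξ) = (1 + cos θ)·cos nθ`, `θ = 2arctan(ξ/8)`, with the FLOAT64 (hence exact dyadic) coefficients of cert-1's even spectral stage
(`HOME/profile/cert/impl2/specS1even/code/h_even_of_record.json` sha16 7c818df40aa404f0 = impl-1 `float-j272952/h_even_candidate.json`, key `h`;
centre_sha16 c4de65e13d80c930; printed `‖h⁺‖²_w = 1.0075811312740…`).  Even twin of selfsim g13's `SheetRLiftOfRecord` (the odd lift).  This file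
TYPES it — `liftFunE := Σ_{i<12} h_{i+1}·(1 + cos θ)cos((i+1)θ)` in the tree's spelled-out companion-function vocabulary of `SheetRCayleySubstitution`
(`coframe_neg`, `abs_coframe_le`, `contDiff_coframe`, `integrable_coframe`, `integral_one_add_cos_mul_cos_cayleyAngle`), `liftEOfRecord : W 8` its
`L²_w` class — and proves:

* §1 `integral_cos_mul_cos` (`∫_{−π}^{π} cos nθ cos mθ = π·δ_{nm}`, `n ≥ 1`) and **`coframe_orthogonal`** — `⟨e_n⁺, e_m⁺⟩_w = 2L³π·δ_{nm}` (twin of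
  `SheetRCayleySubstitution.frame_orthogonal`);
* §2 `tendsto_cayleyAngle_atTop/atBot` (`θ(ξ) → ±π`) and **`integral_coframe_eq_zero`** — every `e_n⁺`, `n ≥ 1`, has ZERO MASS: `∫ e_n⁺ = 0` (its
  `ξ`-primitive is `(L/n)·sin nθ`, which tends to `(L/n)·sin(±nπ) = 0`);
* §3 `integral_weight_coframeSum_sq` — `∫(L² + ξ²)(Σ d_i e_{i+1}⁺)² = 2L³π·Σ d_i²`;
* §4 the lift: **`liftEOfRecord_mem_WevenZ : liftEOfRecord ∈ WevenZ h8`** (row 14⁺: even a.e. by `coframe_neg`, zero mass by §2),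
  `norm_sq_liftEOfRecord : ‖h⁺‖² = 1024π·Σ h_n²` EXACTLY, `Σ h_n² = liftSumSqE` an explicit rational, and
  **`norm_sq_realE_liftEOfRecord_le : ‖realE h8 liftEOfRecord _‖² ≤ hw2E`** (row 13⁺) from `π < 3.14159265358979323847` (`Real.pi_lt_d20`; the
  margin is `7.3·10⁻¹⁰`, so the 7-digit bound would not do) and exact rational arithmetic.
Definitions: `liftTableE` (12 dyadics), `liftCoeffE`, `liftSumSqE`, `liftFunE`, `liftEOfRecord`; no named fact.  WHAT THIS IS NOT: not NS; nothing about
the quality of the lift (it is cert-1's float Riesz lift turned exact); no certificate sentence is proved.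
-/

noncomputable section

namespace Summit.NavierStokesRegularity.OSWSelfSimilar
namespace SheetRLiftEvenOfRecord

open _root_.MeasureTheory _root_.Set _root_.Filter _root_.Real SheetRCayleySubstitution SheetREnergySpace SheetRAssemblyOperators
  SheetRComplexPivot SheetREvenClass SheetREvenEnergySpaceOf SheetRLiftOfRecord
open scoped Topology InnerProductSpace

/-! ### §1 Orthogonality of the even frame `e_n⁺ = (1 + cos θ)cos nθ` -/

/-- `∫_{−π}^{π} cos(nθ)cos(mθ) dθ = π·δ_{nm}` for naturals `n ≥ 1`, `m`. [folklore] -/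
theorem integral_cos_mul_cos {n m : ℕ} (hn : n ≠ 0) :
    ∫ θ in (-π)..π, cos (n * θ) * cos (m * θ) = if n = m then π else 0 := by
  have hprod : ∀ θ : ℝ, cos (n * θ) * cos (m * θ) =
      (cos (((n : ℤ) - m : ℤ) * θ) + cos (((n : ℤ) + m : ℤ) * θ)) / 2 := by
    intro θ
    push_cast
    rw [sub_mul, add_mul, cos_sub, cos_add]
    ring
  simp_rw [hprod]
  rw [intervalIntegral.integral_div, intervalIntegral.integral_add
    ((by fun_prop : Continuous fun θ : ℝ => cos ((((n : ℤ) - m : ℤ) : ℝ) * θ)).intervalIntegrable _ _)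
    ((by fun_prop : Continuous fun θ : ℝ => cos ((((n : ℤ) + m : ℤ) : ℝ) * θ)).intervalIntegrable _ _),
    integral_cos_int_mul (by omega : ((n : ℤ) + m : ℤ) ≠ 0), add_zero]
  split_ifs with h
  · subst h
    simp only [sub_self, Int.cast_zero, zero_mul, cos_zero, intervalIntegral.integral_const, smul_eq_mul, mul_one]
    ring
  · rw [integral_cos_int_mul (by omega : ((n : ℤ) - m : ℤ) ≠ 0), zero_div]

/-- **Orthogonality of the EVEN frame functions in `L²_w`**: with `e_n⁺(ξ) = (1 + cos θ(ξ))·cos nθ(ξ)`, `θ(ξ) = 2·arctan(ξ/L)`,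
`⟨e_n⁺, e_m⁺⟩_w = ∫(L² + ξ²)·e_n⁺(ξ)·e_m⁺(ξ) dξ = 2L³π·δ_{nm}` (`n ≥ 1`, `L > 0`) — the same Gram as the odd frame (DESIGN-Z3-SR-SPEC-EVEN (D1)). [folklore] -/
theorem coframe_orthogonal {L : ℝ} (hL : 0 < L) {n m : ℕ} (hn : n ≠ 0) :
    ∫ ξ, (L ^ 2 + ξ ^ 2) * (((1 + cos (2 * arctan (ξ / L))) * cos (n * (2 * arctan (ξ / L)))) *
        ((1 + cos (2 * arctan (ξ / L))) * cos (m * (2 * arctan (ξ / L))))) =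
      if n = m then 2 * L ^ 3 * π else 0 := by
  rw [integral_weight_mul_comp_cayley hL]
  have heq : EqOn (fun θ => 2 * L ^ 3 / (1 + cos θ) ^ 2 *
        ((1 + cos (2 * arctan (L * tan (θ / 2) / L))) * cos (n * (2 * arctan (L * tan (θ / 2) / L))) *
          ((1 + cos (2 * arctan (L * tan (θ / 2) / L))) * cos (m * (2 * arctan (L * tan (θ / 2) / L))))))
      (fun θ => 2 * L ^ 3 * (cos (n * θ) * cos (m * θ))) (Ioo (-π) π) := by
    intro θ hθ
    have h1 : (1 + cos θ) ≠ 0 := (one_add_cos_pos hθ).ne'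
    simp only [cayleyAngle_cayley hL.ne' hθ]
    field_simp
  rw [setIntegral_congr_fun measurableSet_Ioo heq, integral_const_mul, ← integral_Ioc_eq_integral_Ioo,
    ← intervalIntegral.integral_of_le (by linarith [pi_pos] : -π ≤ π), integral_cos_mul_cos hn]
  split_ifs <;> ring

/-- `(L² + ξ²)·e_n⁺·e_m⁺` is integrable. [folklore] -/
theorem integrable_weight_coframe_mul {L : ℝ} (hL : 0 < L) (n m : ℕ) :
    Integrable fun ξ : ℝ => (L ^ 2 + ξ ^ 2) * (((1 + cos (2 * arctan (ξ / L))) * cos (n * (2 * arctan (ξ / L)))) *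
      ((1 + cos (2 * arctan (ξ / L))) * cos (m * (2 * arctan (ξ / L))))) := by
  refine Integrable.mono' ((SheetRWeightedEmbeddings.integrable_inv_sq_add_sq hL).const_mul (4 * L ^ 4))
    ((by fun_prop : Continuous fun ξ : ℝ => L ^ 2 + ξ ^ 2).mul
      ((contDiff_coframe L n (k := 0)).continuous.mul (contDiff_coframe L m (k := 0)).continuous)).aestronglyMeasurable
    (Filter.Eventually.of_forall fun ξ => ?_)
  have hw : 0 < L ^ 2 + ξ ^ 2 := by positivity
  rw [Real.norm_eq_abs, abs_mul, abs_of_pos hw, abs_mul]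
  have h1 := abs_coframe_le hL.ne' n ξ
  have h2 := abs_coframe_le hL.ne' m ξ
  calc (L ^ 2 + ξ ^ 2) * (|(1 + cos (2 * arctan (ξ / L))) * cos (n * (2 * arctan (ξ / L)))| *
        |(1 + cos (2 * arctan (ξ / L))) * cos (m * (2 * arctan (ξ / L)))|)
      ≤ (L ^ 2 + ξ ^ 2) * (2 * L ^ 2 / (L ^ 2 + ξ ^ 2) * (2 * L ^ 2 / (L ^ 2 + ξ ^ 2))) := by
        refine mul_le_mul_of_nonneg_left (mul_le_mul h1 h2 (abs_nonneg _) (by positivity)) hw.le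
    _ = 4 * L ^ 4 * (L ^ 2 + ξ ^ 2)⁻¹ := by field_simp; ring

/-! ### §2 Zero mass of the even frame functions -/

/-- `θ(ξ) = 2arctan(ξ/L) → π` as `ξ → +∞` (`L > 0`). [folklore] -/
theorem tendsto_cayleyAngle_atTop {L : ℝ} (hL : 0 < L) : Tendsto (fun ξ : ℝ => 2 * arctan (ξ / L)) atTop (𝓝 π) := by
  have h1 : Tendsto (fun ξ : ℝ => ξ / L) atTop atTop := tendsto_id.atTop_div_const hL
  have h2 : Tendsto (fun ξ : ℝ => arctan (ξ / L)) atTop (𝓝 (π / 2)) :=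
    (tendsto_arctan_atTop.mono_right nhdsWithin_le_nhds).comp h1
  have h3 := h2.const_mul 2
  rw [show (2 : ℝ) * (π / 2) = π by ring] at h3
  exact h3

/-- `θ(ξ) = 2arctan(ξ/L) → −π` as `ξ → −∞` (`L > 0`). [folklore] -/
theorem tendsto_cayleyAngle_atBot {L : ℝ} (hL : 0 < L) : Tendsto (fun ξ : ℝ => 2 * arctan (ξ / L)) atBot (𝓝 (-π)) := by
  have h1 : Tendsto (fun ξ : ℝ => ξ / L) atBot atBot := tendsto_id.atBot_div_const hL
  have h2 : Tendsto (fun ξ : ℝ => arctan (ξ / L)) atBot (𝓝 (-(π / 2))) :=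
    (tendsto_arctan_atBot.mono_right nhdsWithin_le_nhds).comp h1
  have h3 := h2.const_mul 2
  rw [show (2 : ℝ) * (-(π / 2)) = -π by ring] at h3
  exact h3

/-- The `ξ`-derivative of `(L/n)·sin nθ(ξ)` is `e_n⁺(ξ)` (`n ≥ 1`, `L ≠ 0`). [folklore] -/
theorem hasDerivAt_sin_cayleyAngle_div {L : ℝ} (hL : L ≠ 0) {n : ℕ} (hn : n ≠ 0) (s : ℝ) :
    HasDerivAt (fun s : ℝ => L / n * sin (n * (2 * arctan (s / L))))
      ((1 + cos (2 * arctan (s / L))) * cos (n * (2 * arctan (s / L)))) s := by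
  have hn' : (n : ℝ) ≠ 0 := Nat.cast_ne_zero.2 hn
  have h1 : HasDerivAt (fun s : ℝ => (n : ℝ) * (2 * arctan (s / L))) ((n : ℝ) * (2 * L / (L ^ 2 + s ^ 2))) s :=
    (hasDerivAt_cayleyAngle hL s).const_mul (n : ℝ)
  have h2 : HasDerivAt (fun s : ℝ => sin ((n : ℝ) * (2 * arctan (s / L))))
      (cos ((n : ℝ) * (2 * arctan (s / L))) * ((n : ℝ) * (2 * L / (L ^ 2 + s ^ 2)))) s :=
    (Real.hasDerivAt_sin _).comp s h1
  refine (h2.const_mul (L / n)).congr_deriv ?_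
  rw [one_add_cos_cayleyAngle hL]
  have : L ^ 2 + s ^ 2 ≠ 0 := by positivity
  field_simp

/-- **ZERO MASS of the even frame functions**: `∫_ℝ (1 + cos θ(ξ))·cos nθ(ξ) dξ = 0` for `n ≥ 1` (`L > 0`) — the `ξ`-primitive `(L/n)·sin nθ` tends to
`(L/n)·sin(±nπ) = 0` at `±∞` (Mathlib `integral_of_hasDerivAt_of_tendsto`).  DESIGN-Z3-SR-SPEC-EVEN (D1): `e_n⁺ ∈ E⁺₀`, the massive direction is `e_0⁺`
alone. [folklore] -/
theorem integral_coframe_eq_zero {L : ℝ} (hL : 0 < L) {n : ℕ} (hn : n ≠ 0) :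
    ∫ ξ, (1 + cos (2 * arctan (ξ / L))) * cos (n * (2 * arctan (ξ / L))) = 0 := by
  have hcont : Continuous fun t : ℝ => L / n * sin (n * t) := by fun_prop
  have htop : Tendsto (fun ξ : ℝ => L / n * sin (n * (2 * arctan (ξ / L)))) atTop (𝓝 (L / n * sin (n * π))) :=
    (hcont.tendsto π).comp (tendsto_cayleyAngle_atTop hL)
  have hbot : Tendsto (fun ξ : ℝ => L / n * sin (n * (2 * arctan (ξ / L)))) atBot (𝓝 (L / n * sin (n * (-π)))) :=
    (hcont.tendsto (-π)).comp (tendsto_cayleyAngle_atBot hL)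
  rw [sin_nat_mul_pi] at htop
  rw [mul_neg, sin_neg, sin_nat_mul_pi, neg_zero] at hbot
  rw [integral_of_hasDerivAt_of_tendsto (hasDerivAt_sin_cayleyAngle_div hL.ne' hn) (integrable_coframe hL n) hbot htop]
  ring

/-! ### §3 The weighted square integral of an even frame sum -/

/-- **`∫(L² + ξ²)·(Σ_{i<N} d_i e_{i+1}⁺)² = 2L³π·Σ_{i<N} d_i²`** (orthogonality `∫ w e_n⁺ e_m⁺ = 2L³π·δ_{nm}` of the even frame). [folklore] -/
theorem integral_weight_coframeSum_sq {L : ℝ} (hL : 0 < L) (N : ℕ) (d : ℕ → ℝ) :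
    ∫ ξ, (L ^ 2 + ξ ^ 2) * (∑ i ∈ Finset.range N, d i * ((1 + cos (2 * arctan (ξ / L))) * cos ((i + 1 : ℕ) * (2 * arctan (ξ / L))))) ^ 2 =
      2 * L ^ 3 * π * ∑ i ∈ Finset.range N, d i ^ 2 := by
  have hexp : ∀ ξ : ℝ, (L ^ 2 + ξ ^ 2) *
      (∑ i ∈ Finset.range N, d i * ((1 + cos (2 * arctan (ξ / L))) * cos ((i + 1 : ℕ) * (2 * arctan (ξ / L))))) ^ 2 =
      ∑ i ∈ Finset.range N, ∑ j ∈ Finset.range N, d i * d j * ((L ^ 2 + ξ ^ 2) *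
        (((1 + cos (2 * arctan (ξ / L))) * cos ((i + 1 : ℕ) * (2 * arctan (ξ / L)))) *
          ((1 + cos (2 * arctan (ξ / L))) * cos ((j + 1 : ℕ) * (2 * arctan (ξ / L)))))) := by
    intro ξ
    rw [pow_two (∑ i ∈ Finset.range N, d i * ((1 + cos (2 * arctan (ξ / L))) * cos ((i + 1 : ℕ) * (2 * arctan (ξ / L))))),
      Finset.sum_mul_sum, Finset.mul_sum]
    refine Finset.sum_congr rfl fun i _ => ?_
    rw [Finset.mul_sum]
    refine Finset.sum_congr rfl fun j _ => ?_
    ring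
  simp_rw [hexp]
  rw [integral_finsetSum _ fun i _ => integrable_finsetSum _ fun j _ => (integrable_weight_coframe_mul hL (i + 1) (j + 1)).const_mul _]
  rw [Finset.mul_sum]
  refine Finset.sum_congr rfl fun i hiN => ?_
  rw [integral_finsetSum _ fun j _ => (integrable_weight_coframe_mul hL (i + 1) (j + 1)).const_mul _]
  have hij : ∀ j ∈ Finset.range N, ∫ ξ, d i * d j * ((L ^ 2 + ξ ^ 2) *
      (((1 + cos (2 * arctan (ξ / L))) * cos ((i + 1 : ℕ) * (2 * arctan (ξ / L)))) *
        ((1 + cos (2 * arctan (ξ / L))) * cos ((j + 1 : ℕ) * (2 * arctan (ξ / L)))))) =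
      if i = j then d i * d j * (2 * L ^ 3 * π) else 0 := by
    intro j _
    rw [integral_const_mul, coframe_orthogonal hL (n := i + 1) (m := j + 1) (Nat.succ_ne_zero i)]
    by_cases hij : i = j
    · subst hij; simp
    · simp [hij]
  rw [Finset.sum_congr rfl hij, Finset.sum_ite_eq]
  have hi : i ∈ Finset.range N := hiN
  rw [if_pos hi]
  ring

/-! ### §4 Data: the 12 dyadic coefficients, the lift as a function and as an element of `L²_w` -/

/-- The 12 even-frame coefficients `h_1..h_12` of the even lift of record as `(p, e)`, `h_n = p/2^e` (exact values of the printed float64s of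
`h_even_of_record.json` 7c818df40aa404f0, key `h`). [folklore] -/
def liftTableE : List (ℤ × ℕ) := [(-347105250500813, 61), (-2192063850508627, 58), (-3151896362937425, 59), (-157500096812171, 54),
  (-7186528146319233, 60), (-7835467127416695, 60), (-296263203695283, 56), (-4674810181399395, 60), (-5898291404547747, 61),
  (-1128017288166405, 58), (-6478318467266259, 61), (-4295086000961099, 62)]

/-- The coefficient function `i ↦ h_{i+1}` (real, `0` beyond the table). [folklore] -/
def liftCoeffE (i : ℕ) : ℝ := ((liftTableE.getD i (0, 0)).1 : ℝ) / (2 : ℝ) ^ (liftTableE.getD i (0, 0)).2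

/-- `Σ_{n≤12} h_n²` as an exact rational. [folklore] -/
def liftSumSqE : ℚ := 6661156832863262448596952731403605 / 21267647932558653966460912964485513216

/-- **The even lift as a function**: `h⁺(ξ) = Σ_{i<12} h_{i+1}·(1 + cos θ)cos((i+1)θ)`, `θ = 2arctan(ξ/8)`. [folklore] -/
def liftFunE (ξ : ℝ) : ℝ :=
  ∑ i ∈ Finset.range 12, liftCoeffE i * ((1 + cos (2 * arctan (ξ / 8))) * cos ((i + 1 : ℕ) * (2 * arctan (ξ / 8))))

/-- `h⁺` is continuous. [folklore] -/
theorem continuous_liftFunE : Continuous liftFunE :=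
  continuous_finsetSum _ fun i _ => continuous_const.mul (contDiff_coframe 8 (i + 1) (k := 0)).continuous

/-- `h⁺` is EVEN: `h⁺(−ξ) = h⁺(ξ)`. [folklore] -/
theorem liftFunE_neg (ξ : ℝ) : liftFunE (-ξ) = liftFunE ξ := by
  simp only [liftFunE]
  refine Finset.sum_congr rfl fun i _ => ?_
  rw [coframe_neg 8 (i + 1) ξ]

/-- `h⁺` is integrable and has ZERO MASS: `∫ h⁺ = 0`. [folklore] -/
theorem integrable_liftFunE_and_integral : Integrable liftFunE ∧ ∫ ξ, liftFunE ξ = 0 := by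
  have hint : ∀ i ∈ Finset.range 12,
      Integrable fun ξ : ℝ => liftCoeffE i * ((1 + cos (2 * arctan (ξ / 8))) * cos ((i + 1 : ℕ) * (2 * arctan (ξ / 8)))) :=
    fun i _ => (integrable_coframe (by norm_num : (0:ℝ) < 8) (i + 1)).const_mul _
  refine ⟨(integrable_finsetSum _ hint).congr (Eventually.of_forall fun ξ => ?_), ?_⟩
  · simp only [liftFunE]
  · have e : (fun ξ => liftFunE ξ) =
        fun ξ => ∑ i ∈ Finset.range 12, liftCoeffE i * ((1 + cos (2 * arctan (ξ / 8))) * cos ((i + 1 : ℕ) * (2 * arctan (ξ / 8)))) := rfl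
    rw [e, integral_finsetSum _ hint]
    refine Finset.sum_eq_zero fun i _ => ?_
    rw [integral_const_mul, integral_coframe_eq_zero (by norm_num : (0:ℝ) < 8) (Nat.succ_ne_zero i), mul_zero]

/-- `|h⁺(ξ)| ≤ (2·8²·Σ|h_n|)/(8² + ξ²)`. [folklore] -/
theorem abs_liftFunE_le (ξ : ℝ) : |liftFunE ξ| ≤ (2 * (8:ℝ) ^ 2 * ∑ i ∈ Finset.range 12, |liftCoeffE i|) / ((8:ℝ) ^ 2 + ξ ^ 2) := by
  rw [liftFunE, Finset.mul_sum, Finset.sum_div]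
  refine (Finset.abs_sum_le_sum_abs _ _).trans (Finset.sum_le_sum fun i _ => ?_)
  rw [abs_mul]
  have h := abs_coframe_le (by norm_num : (8:ℝ) ≠ 0) (i + 1) ξ
  calc |liftCoeffE i| * |(1 + cos (2 * arctan (ξ / 8))) * cos ((i + 1 : ℕ) * (2 * arctan (ξ / 8)))|
      ≤ |liftCoeffE i| * (2 * (8:ℝ) ^ 2 / ((8:ℝ) ^ 2 + ξ ^ 2)) := mul_le_mul_of_nonneg_left h (abs_nonneg _)
    _ = 2 * (8:ℝ) ^ 2 * |liftCoeffE i| / ((8:ℝ) ^ 2 + ξ ^ 2) := by ring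

/-- `∫(64 + ξ²)·h⁺(ξ)² < ∞`. [folklore] -/
theorem integrable_weight_liftFunE_sq : Integrable fun ξ => ((8:ℝ) ^ 2 + ξ ^ 2) * liftFunE ξ ^ 2 :=
  SheetRFrameCentre.integrable_weight_sq_of_le (by norm_num : (0:ℝ) < 8) continuous_liftFunE abs_liftFunE_le

/-- `h⁺ ∈ L²_w`. [folklore] -/
theorem memLp_liftFunE : MemLp liftFunE 2 (μw 8) :=
  memLp_W continuous_liftFunE.aestronglyMeasurable integrable_weight_liftFunE_sq

/-- **THE EVEN LIFT OF RECORD** as an element of `W 8 = L²((64 + ξ²)dξ)`. [folklore] -/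
def liftEOfRecord : W 8 := memLp_liftFunE.toLp liftFunE

/-- Its representative is a.e. `liftFunE`, and `‖h⁺‖ = (∫(64 + ξ²)h⁺²)^{1/2}`. [folklore] -/
theorem liftEOfRecord_ae_and_norm :
    (((liftEOfRecord : W 8) : ℝ → ℝ) =ᵐ[volume] liftFunE) ∧ ‖liftEOfRecord‖ = Real.sqrt (∫ y, ((8:ℝ) ^ 2 + y ^ 2) * liftFunE y ^ 2) :=
  norm_toLp_W (by norm_num) memLp_liftFunE

/-- **Row 14⁺: the even lift is EVEN with ZERO MASS**, `liftEOfRecord ∈ WevenZ h8`. [folklore] -/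
theorem liftEOfRecord_mem_WevenZ (h8 : (0:ℝ) < 8) : liftEOfRecord ∈ WevenZ h8 := by
  rw [mem_WevenZ_iff_ae h8]
  have hae := liftEOfRecord_ae_and_norm.1
  have hneg : (fun y => ((liftEOfRecord : W 8) : ℝ → ℝ) (-y)) =ᵐ[volume] fun y => liftFunE (-y) :=
    (Measure.measurePreserving_neg (volume : Measure ℝ)).quasiMeasurePreserving.ae_eq_comp hae
  refine ⟨?_, ?_⟩
  · filter_upwards [hae, hneg] with y hy hny
    rw [hny, hy]
    exact liftFunE_neg y
  · rw [integral_congr_ae hae]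
    exact integrable_liftFunE_and_integral.2

/-- **`‖h⁺‖² = 1024π·Σ h_n²`** exactly. [folklore] -/
theorem norm_sq_liftEOfRecord : ‖liftEOfRecord‖ ^ 2 = 2 * (8:ℝ) ^ 3 * π * ∑ i ∈ Finset.range 12, liftCoeffE i ^ 2 := by
  rw [liftEOfRecord_ae_and_norm.2, Real.sq_sqrt (integral_nonneg fun y => by positivity)]
  exact integral_weight_coframeSum_sq (by norm_num) 12 liftCoeffE

/-- `Σ_{i<12} h_{i+1}² = liftSumSqE` (exact rational arithmetic on the 12 dyadics). [folklore] -/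
theorem sum_sq_liftCoeffE : ∑ i ∈ Finset.range 12, liftCoeffE i ^ 2 = ((liftSumSqE : ℚ) : ℝ) := by
  simp only [Finset.sum_range_succ, Finset.sum_range_zero, liftCoeffE, liftTableE, List.getD_cons_succ, List.getD_cons_zero, liftSumSqE]
  push_cast
  norm_num

/-- `‖realE h8 g _‖ = ‖ofRealW 8 g‖` (the class in `WcevenZ` carries the norm of its `L²_w(ℂ)` representative). [folklore] -/
theorem norm_realE (h8 : (0:ℝ) < 8) (g : W 8) (hg : g ∈ WevenZ h8) : ‖realE h8 g hg‖ = ‖ofRealW 8 g‖ := rfl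

/-- **Row 13⁺: `‖h⁺ + 0i‖² ≤ hw2E`** (`hw2E = 251895283/250000000`; uses `π < 3.14159265358979323847`, margin `7.3·10⁻¹⁰`). [folklore] -/
theorem norm_sq_realE_liftEOfRecord_le (h8 : (0:ℝ) < 8) :
    ‖realE h8 liftEOfRecord (liftEOfRecord_mem_WevenZ h8)‖ ^ 2 ≤ ((CertificateViscousSheetRSpectrumEven.hw2E : ℚ) : ℝ) := by
  rw [norm_realE, norm_sq_ofRealW, norm_sq_liftEOfRecord, sum_sq_liftCoeffE, CertificateViscousSheetRSpectrumEven.hw2E, liftSumSqE]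
  have hπ := Real.pi_lt_d20
  have hπ0 := Real.pi_pos
  push_cast
  nlinarith

end SheetRLiftEvenOfRecord
end Summit.NavierStokesRegularity.OSWSelfSimilar

end
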